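import Summits.QuantumAdvantage.AdviceFreeQNC0.AffBells25Omega
import Summits.QuantumAdvantage.AdviceFreeQNC0.AffBells25FullSupportRigidity
import HarnessLib

/-!
# Theorem B′ chain, part 2: linearisation (L3) and the class coefficient of a row

Prover seat qn-prover-3 g14 (ask P-25 of planner qn-p1 g25, ROUND-24 §2.10 (a)).  Over the typed chain
`AffBells25RigidityChain.lean` (= Sketch25L verbatim) and part 1 (`AffBells25Omega.lean`) we prove:

* **`linearisation : Linearisation`** (L3): if an XOR of `K` full-support tests is constant `= b` on the parity
  class `P_σ`, then for every sign vector `δ`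
  `A_δ = (K + b)·ω^{⟨δ,1⟩} + ω^{−⟨δ,1⟩}·F_S(δ)`, `S = {y ∈ P_{σ+1} : XOR(y) ≠ b}`.
  Proof: in `R` the XOR is the SUM of the tests (`bit_xorTests`, parity casts), each test is
  `1 + ω^{−c}χ_γ + ω^{c}χ_{−γ}` (L1), so `Σ_g test_g(y) = K + Σ_g (…)`; on the whole cube this function equals
  `b + 1_S` (`sum_tests_eq_indicator`); pairing both sides with the kernel `ω^{−⟨δ,1−y⟩}` and using
  orthogonality (L2) for `±γ_g` extracts `K·ω^{⟨δ,1⟩} + A_δ` on the left and `b·ω^{⟨δ,1⟩} + ω^{−⟨δ,1⟩}F_S(δ)` on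
  the right.
* **`coefA_self_eq_sum_classCount`**: `A_{γ_{g₀}} = Σ_r m_r ω^{−r}` with `m_r = classCount γ c g₀ r`, and
  **`classCount_mod_two_eq_of_coefA_eq_zero`**: `A_{γ_{g₀}} = 0 ⇒` the class of `g₀` is balanced (independence of
  `{1, ω}`), i.e. contrapositively an UNBALANCED class has a non-zero coefficient.

WHAT THIS IS NOT: instrument for the (NP₀) rung of crux stmt-QuantumAdvantage-22907 (route DWalkThree); no route item;
separation NOT moved.
-/

namespace Summit.QuantumAdvantage.AdviceFreeQNC0

namespace AffBells25L

open Finset AffBells24 Polynomial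

/-! ### The XOR is the sum of the tests in `R` -/

/-- A natural number cast into `R` is the bit of its parity test. -/
theorem natCast_eq_bit (n : ℕ) : (n : R) = if decide (n % 2 = 1) then (1 : R) else 0 := by
  rw [F4.natCast_eq n]
  by_cases h : n % 2 = 1
  · rw [if_pos h, decide_eq_true h, if_pos rfl]
  · rw [if_neg h, decide_eq_false h]; rfl

/-- In `R`, the XOR of a family of tests is the SUM of the tests. -/
theorem bit_xorTests {Z K : ℕ} (γ : Fin K → Fin Z → ZMod 3) (c : Fin K → ZMod 3) (y : Fin Z → Bool) :
    (if xorTests γ c y then (1 : R) else 0) = ∑ g, (if test (γ g) (c g) y then (1 : R) else 0) := by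
  unfold xorTests
  rw [← natCast_card_filter, natCast_eq_bit]

/-- The sum of the tests, expanded by (L1): `Σ_g test_g(y) = K + Σ_g (ω^{−c_g}χ_{γ_g}(y) + ω^{c_g}χ_{−γ_g}(y))`. -/
theorem sum_tests_eq {Z K : ℕ} (γ : Fin K → Fin Z → ZMod 3) (c : Fin K → ZMod 3) (y : Fin Z → Bool) :
    (∑ g, (if test (γ g) (c g) y then (1 : R) else 0)) =
      (K : R) + ∑ g, (ωpow (-(c g)) * chi (γ g) y + ωpow (c g) * chi (-(γ g)) y) := by
  simp_rw [test_eq]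
  rw [sum_add_distrib, sum_add_distrib, sum_add_distrib, sum_const, card_univ, Fintype.card_fin,
    nsmul_eq_mul, mul_one, add_assoc]

/-! ### Pairing with the kernel: the left-hand side -/

/-- `A_δ` as a sum over all rows with indicators. -/
theorem coefA_eq_sum_ite {Z K : ℕ} (γ : Fin K → Fin Z → ZMod 3) (c : Fin K → ZMod 3)
    (δ : Fin Z → ZMod 3) :
    coefA γ c δ = ∑ g, ((if γ g = δ then ωpow (-(c g)) else 0) + (if γ g = -δ then ωpow (c g) else 0)) := by
  unfold coefA
  rw [sum_filter, sum_filter, sum_add_distrib]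

/-- Pairing the expanded test sum with the kernel extracts `K·ω^{⟨δ,1⟩} + A_δ` (orthogonality for `±γ_g`). -/
theorem sum_dualKer_mul_sum_tests {Z K : ℕ} (γ : Fin K → Fin Z → ZMod 3) (c : Fin K → ZMod 3)
    (hfull : ∀ g e, γ g e ≠ 0) (δ : Fin Z → ZMod 3) (hδ : IsSign δ) :
    (∑ y : Fin Z → Bool, dualKer δ y * ∑ g, (if test (γ g) (c g) y then (1 : R) else 0)) =
      (K : R) * piOne δ + coefA γ c δ := by
  have step : ∀ y : Fin Z → Bool, dualKer δ y * ∑ g, (if test (γ g) (c g) y then (1 : R) else 0) =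
      (K : R) * dualKer δ y +
        ∑ g, (ωpow (-(c g)) * (dualKer δ y * chi (γ g) y) + ωpow (c g) * (dualKer δ y * chi (-(γ g)) y)) := by
    intro y
    rw [sum_tests_eq, mul_add, mul_sum]
    congr 1
    · ring
    · refine sum_congr rfl fun g _ => ?_
      ring
  rw [sum_congr rfl fun y _ => step y, sum_add_distrib, ← mul_sum, sum_dualKer δ hδ, sum_comm]
  congr 1
  rw [coefA_eq_sum_ite]
  refine sum_congr rfl fun g _ => ?_
  have hs : IsSign (-(γ g)) := fun e => by rw [Pi.neg_apply]; exact neg_ne_zero.mpr (hfull g e)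
  rw [sum_add_distrib, ← mul_sum, ← mul_sum, orthogonality Z (γ g) δ (hfull g) hδ,
    orthogonality Z (-(γ g)) δ hs hδ, mul_boole, mul_boole]
  congr 1
  exact if_congr neg_eq_iff_eq_neg rfl rfl

/-! ### The right-hand side: on the whole cube the test sum is `b + 1_S` -/

/-- The two parity classes partition the cube: `y ∈ P_{σ+1} ↔ y ∉ P_σ`. -/
theorem mem_parityClass_succ_iff {Z : ℕ} (σ : ℕ) (y : Fin Z → Bool) :
    y ∈ parityClass Z (σ + 1) ↔ y ∉ parityClass Z σ := by
  unfold parityClass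
  rw [mem_filter, mem_filter]
  simp only [mem_univ, true_and]
  omega

/-- `bit (!b) = bit b + 1` in `R`. -/
theorem bit_not (b : Bool) : (if (!b) then (1 : R) else 0) = (if b then (1 : R) else 0) + 1 := by
  cases b
  · simp
  · simp [F4.add_self]

/-- Under the hypothesis `XOR ≡ b on P_σ`: on the WHOLE cube, `bit (XOR y) = bit b + 1_S(y)` with
`S = excS γ c σ b = {y ∈ P_{σ+1} : XOR y ≠ b}`. -/
theorem bit_xorTests_eq_indicator {Z K : ℕ} (σ : ℕ) (γ : Fin K → Fin Z → ZMod 3) (c : Fin K → ZMod 3)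
    (b : Bool) (hconst : ∀ y ∈ parityClass Z σ, xorTests γ c y = b) (y : Fin Z → Bool) :
    (if xorTests γ c y then (1 : R) else 0) =
      (if b then (1 : R) else 0) + (if y ∈ excS γ c σ b then 1 else 0) := by
  unfold excS
  by_cases hy : y ∈ parityClass Z σ
  · have hnot : y ∉ (parityClass Z (σ + 1)).filter fun y => xorTests γ c y ≠ b := by
      rw [mem_filter, mem_parityClass_succ_iff]
      exact fun h => h.1 hy
    rw [hconst y hy, if_neg hnot, add_zero]
  · by_cases hx : xorTests γ c y = b
    · have hnot : y ∉ (parityClass Z (σ + 1)).filter fun y => xorTests γ c y ≠ b := by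
        rw [mem_filter]
        exact fun h => h.2 hx
      rw [hx, if_neg hnot, add_zero]
    · have hmem : y ∈ (parityClass Z (σ + 1)).filter fun y => xorTests γ c y ≠ b := by
        rw [mem_filter, mem_parityClass_succ_iff]
        exact ⟨hy, hx⟩
      rw [if_pos hmem]
      have hx' : xorTests γ c y = !b := by
        revert hx; cases xorTests γ c y <;> cases b <;> simp
      rw [hx', bit_not]

/-- Pairing `b + 1_S` with the kernel gives `b·ω^{⟨δ,1⟩} + ω^{−⟨δ,1⟩}·F_S(δ)`. -/
theorem sum_dualKer_mul_indicator {Z : ℕ} (S : Finset (Fin Z → Bool)) (b : Bool) (δ : Fin Z → ZMod 3)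
    (hδ : IsSign δ) :
    (∑ y : Fin Z → Bool, dualKer δ y * ((if b then (1 : R) else 0) + (if y ∈ S then 1 else 0))) =
      (if b then (1 : R) else 0) * piOne δ + ωpow (-(∑ e, δ e)) * FS S δ := by
  simp_rw [mul_add, sum_add_distrib]
  congr 1
  · rw [← sum_mul, sum_dualKer δ hδ, mul_comm]
  · simp_rw [mul_boole]
    rw [Finset.sum_ite_mem_eq]
    unfold FS
    rw [mul_sum]
    exact sum_congr rfl fun y _ => dualKer_eq δ y

/-! ### (L3) -/

/-- **(L3)** LINEARISATION: an XOR of `K` full-support tests constant `= b` on `P_σ` forces, for every sign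
vector `δ`, `A_δ = (K + b)·ω^{⟨δ,1⟩} + ω^{−⟨δ,1⟩}·F_S(δ)` with `S = excS γ c σ b`. -/
theorem linearisation : Linearisation := by
  intro Z K σ γ c b hfull hconst δ hδ
  have hL := sum_dualKer_mul_sum_tests γ c hfull δ hδ
  have hR := sum_dualKer_mul_indicator (excS γ c σ b) b δ hδ
  have hmid : (∑ y : Fin Z → Bool, dualKer δ y * ∑ g, (if test (γ g) (c g) y then (1 : R) else 0)) =
      ∑ y : Fin Z → Bool, dualKer δ y * ((if b then (1 : R) else 0) + (if y ∈ excS γ c σ b then 1 else 0)) := by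
    refine sum_congr rfl fun y _ => ?_
    rw [← bit_xorTests, bit_xorTests_eq_indicator σ γ c b hconst y]
  rw [hmid, hR] at hL
  -- hL : b·π + ω^{-Σδ} F = K·π + A
  rw [eq_add_of_add_eq hL.symm]
  ring

/-! ### The class coefficient of a row -/

/-- For a full-support row (and `Z ≥ 1`), `γ_{g₀} ≠ −γ_{g₀}`. -/
theorem self_ne_neg {Z K : ℕ} (γ : Fin K → Fin Z → ZMod 3) (hfull : ∀ g e, γ g e ≠ 0) (hZ : 0 < Z)
    (g₀ : Fin K) : γ g₀ ≠ -γ g₀ := by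
  intro heq
  have h0 := congrFun heq ⟨0, hZ⟩
  rw [Pi.neg_apply] at h0
  have : ∀ a : ZMod 3, a = -a → a = 0 := by decide
  exact hfull g₀ _ (this _ h0)

/-- **The coefficient of a row's own class is the signed-residue generating sum**:
`A_{γ_{g₀}} = Σ_r (classCount γ c g₀ r)·ω^{−r}`. -/
theorem coefA_self_eq_sum_classCount {Z K : ℕ} (γ : Fin K → Fin Z → ZMod 3) (c : Fin K → ZMod 3)
    (g₀ : Fin K) (hne : γ g₀ ≠ -γ g₀) :
    coefA γ c (γ g₀) = ∑ r : ZMod 3, (AffBells25.classCount γ c g₀ r : R) * ωpow (-r) := by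
  unfold AffBells25.classCount
  simp_rw [natCast_card_filter, sum_mul]
  rw [sum_comm, coefA_eq_sum_ite]
  refine sum_congr rfl fun g _ => ?_
  simp_rw [ite_mul, one_mul, zero_mul]
  by_cases h1 : γ g = γ g₀
  · have h2 : ¬ γ g = -γ g₀ := fun h => hne (h1 ▸ h)
    rw [if_pos h1, if_neg h2, add_zero]
    have hiff : ∀ r, ((γ g = γ g₀ ∧ c g = r) ∨ (γ g = -γ g₀ ∧ c g = -r)) ↔ c g = r := fun r =>
      ⟨fun h => h.elim (fun h => h.2) (fun h => absurd h.1 h2), fun h => Or.inl ⟨h1, h⟩⟩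
    rw [sum_congr rfl fun r _ => if_congr (hiff r) rfl rfl, sum_ite_eq, if_pos (mem_univ _)]
  · by_cases h2 : γ g = -γ g₀
    · rw [if_neg h1, if_pos h2, zero_add]
      have hiff : ∀ r, ((γ g = γ g₀ ∧ c g = r) ∨ (γ g = -γ g₀ ∧ c g = -r)) ↔ -(c g) = r := fun r =>
        ⟨fun h => h.elim (fun h => absurd h.1 h1) (fun h => by rw [h.2, neg_neg]),
          fun h => Or.inr ⟨h2, by rw [← h, neg_neg]⟩⟩
      rw [sum_congr rfl fun r _ => if_congr (hiff r) rfl rfl, sum_ite_eq, if_pos (mem_univ _), neg_neg]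
    · rw [if_neg h1, if_neg h2, add_zero]
      symm
      refine sum_eq_zero fun r _ => ?_
      rw [if_neg]
      rintro (⟨h, _⟩ | ⟨h, _⟩)
      · exact h1 h
      · exact h2 h

/-- Expanding the generating sum in the basis `{1, ω}`:
`Σ_r m_r ω^{−r} = (m₀ + m₁) + (m₁ + m₂)·ω`. -/
theorem sum_classCount_ωpow {Z K : ℕ} (γ : Fin K → Fin Z → ZMod 3) (c : Fin K → ZMod 3) (g₀ : Fin K) :
    (∑ r : ZMod 3, (AffBells25.classCount γ c g₀ r : R) * ωpow (-r)) =
      ((AffBells25.classCount γ c g₀ 0 + AffBells25.classCount γ c g₀ 1 : ℕ) : R) +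
        ((AffBells25.classCount γ c g₀ 1 + AffBells25.classCount γ c g₀ 2 : ℕ) : R) * ω := by
  have huniv : (univ : Finset (ZMod 3)) = {0, 1, 2} := by decide
  rw [huniv, sum_insert (by decide), sum_insert (by decide), sum_singleton]
  rw [neg_zero, ωpow_zero, show (-1 : ZMod 3) = 2 from rfl, show (-2 : ZMod 3) = 1 from rfl, ωpow_one,
    ωpow_two, omega_eq_F4, F4.omega_sq]
  push_cast
  ring

/-- **A vanishing class coefficient means a balanced class**: `A_{γ_{g₀}} = 0 ⇒ m_r ≡ m_s (mod 2)` for all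
residues `r, s` (independence of `{1, ω}` over `𝔽₂`). -/
theorem classCount_mod_two_eq_of_coefA_eq_zero {Z K : ℕ} (γ : Fin K → Fin Z → ZMod 3) (c : Fin K → ZMod 3)
    (g₀ : Fin K) (hne : γ g₀ ≠ -γ g₀) (h : coefA γ c (γ g₀) = 0) (r s : ZMod 3) :
    AffBells25.classCount γ c g₀ r % 2 = AffBells25.classCount γ c g₀ s % 2 := by
  rw [coefA_self_eq_sum_classCount γ c g₀ hne, sum_classCount_ωpow] at h
  obtain ⟨h01, h12⟩ := even_of_natCast_add_natCast_mul_omega h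
  have h3 : ∀ d : ZMod 3, d = 0 ∨ d = 1 ∨ d = 2 := by decide
  rcases h3 r with rfl | rfl | rfl <;> rcases h3 s with rfl | rfl | rfl <;> omega

/-- Contrapositive, the form used in the assembly: an unbalanced class has `A_{γ_{g₀}} ≠ 0`. -/
theorem coefA_self_ne_zero_of_unbalanced {Z K : ℕ} (γ : Fin K → Fin Z → ZMod 3) (c : Fin K → ZMod 3)
    (g₀ : Fin K) (hne : γ g₀ ≠ -γ g₀) {r s : ZMod 3}
    (h : AffBells25.classCount γ c g₀ r % 2 ≠ AffBells25.classCount γ c g₀ s % 2) :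
    coefA γ c (γ g₀) ≠ 0 :=
  fun h0 => h (classCount_mod_two_eq_of_coefA_eq_zero γ c g₀ hne h0 r s)

end AffBells25L

end Summit.QuantumAdvantage.AdviceFreeQNC0
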